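import Mathlib
import HarnessLib

/-!
# Frobenius decomposition of a finitely generated subextension over a perfect field

(crux `IndSmooth.ValuativeSmoothing`, stmt-ResolutionOfSingularities-16087, line `birth`,
lead c1 devissage programme "discrete jumps": stub `exists_sum_frobenius_mul_monomial`.)

Let `k` be a perfect field of characteristic `p > 0`, `L/k` a field extension and
`a : ι → L` a finite family.  Put `F := k(a i : i ∈ ι) = IntermediateField.adjoin k (range a)`.
We prove that `F = F^p[a]` in the explicit form needed for Mac Lane's separability
criterion: every `x ∈ F` can be written as
`x = ∑_{α : ι → Fin p} (c α)^p * ∏ i, (a i)^(α i)` with all `c α ∈ F`.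
No algebraic independence of the `a i` is assumed (the representation need not be unique),
and some `a i` may vanish.

Proof: the set of elements of `L` admitting such a representation ("normal forms") contains
every single term `d^p * ∏ i, (a i)^(n i)` with `d ∈ F` and arbitrary exponents (reduce the
exponents mod `p`, absorbing `(a i)^(p * (n i / p))` into the `p`-th power), is closed under
addition (Frobenius is additive in characteristic `p`), hence under multiplication, contains
the image of `k` (as `k = k^p`) and the `a i`, and is closed under inversion of elements of
`F` since `x⁻¹ = x^(p-1) * (x⁻¹)^p`.  The claim then follows by
`IntermediateField.adjoin_induction`.

Source: this is the classical fact that a family `B` generating `K = k₀(B)` over a perfect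
field `k₀` also `p`-generates it, `K = K^p(k₀, B) = K^p(B)`, so that `K` is spanned over `K^p`
by the `p`-monomials of `B` (Matsumura, *Commutative Ring Theory*, §26: `p`-monomials before
Thm 26.5, and the remark `k^p(k₀) = k^p` for perfect `k₀` before Thm 26.7).
-/

-- single-problem summit: the doubled namespace component is forced
set_option linter.dupNamespace false

namespace Summit.ResolutionOfSingularities.ResolutionOfSingularities.Theorems.ValuativeSmoothing

section Helpers

/-! ### Normal forms

We say (only in this docstring) that `x : L` is a *normal form* if
`∃ c : (ι → Fin p) → L, (∀ α, c α ∈ F) ∧ x = ∑ α, c α ^ p * ∏ i, a i ^ (α i : ℕ)`;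
the helper lemmas below spell this predicate out explicitly. -/

variable {p : ℕ} [Fact p.Prime] {k L : Type} [Field k] [Field L] [Algebra k L]
  {ι : Type} [Fintype ι] [DecidableEq ι] {F : IntermediateField k L} {a : ι → L}

/-- `0` is a normal form. -/
private theorem isFrobSum_zero :
    ∃ c : (ι → Fin p) → L, (∀ α, c α ∈ F) ∧
      (0 : L) = ∑ α : ι → Fin p, c α ^ p * ∏ i, a i ^ ((α i : ℕ)) :=
  ⟨0, fun _ => zero_mem F, by simp [zero_pow (Fact.out : p.Prime).ne_zero]⟩

/-- Normal forms are closed under addition (Frobenius is additive). -/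
private theorem isFrobSum_add [CharP L p] {x y : L}
    (hx : ∃ c : (ι → Fin p) → L, (∀ α, c α ∈ F) ∧
      x = ∑ α : ι → Fin p, c α ^ p * ∏ i, a i ^ ((α i : ℕ)))
    (hy : ∃ c : (ι → Fin p) → L, (∀ α, c α ∈ F) ∧
      y = ∑ α : ι → Fin p, c α ^ p * ∏ i, a i ^ ((α i : ℕ))) :
    ∃ c : (ι → Fin p) → L, (∀ α, c α ∈ F) ∧
      x + y = ∑ α : ι → Fin p, c α ^ p * ∏ i, a i ^ ((α i : ℕ)) := by
  obtain ⟨c, hc, rfl⟩ := hx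
  obtain ⟨d, hd, rfl⟩ := hy
  refine ⟨c + d, fun α => add_mem (hc α) (hd α), ?_⟩
  rw [← Finset.sum_add_distrib]
  refine Finset.sum_congr rfl fun α _ => ?_
  rw [Pi.add_apply, add_pow_char, add_mul]

/-- Normal forms are closed under finite sums. -/
private theorem isFrobSum_sum [CharP L p] {β : Type} (s : Finset β) (f : β → L)
    (h : ∀ b ∈ s, ∃ c : (ι → Fin p) → L, (∀ α, c α ∈ F) ∧
      f b = ∑ α : ι → Fin p, c α ^ p * ∏ i, a i ^ ((α i : ℕ))) :
    ∃ c : (ι → Fin p) → L, (∀ α, c α ∈ F) ∧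
      ∑ b ∈ s, f b = ∑ α : ι → Fin p, c α ^ p * ∏ i, a i ^ ((α i : ℕ)) :=
  Finset.sum_induction f (fun x => ∃ c : (ι → Fin p) → L, (∀ α, c α ∈ F) ∧
      x = ∑ α : ι → Fin p, c α ^ p * ∏ i, a i ^ ((α i : ℕ)))
    (fun _ _ => isFrobSum_add) isFrobSum_zero h

/-- A single term `d ^ p * ∏ i, a i ^ n i` with `d ∈ F` and *arbitrary* exponents `n` is a
normal form: reduce the exponents modulo `p`. -/
private theorem isFrobSum_term (ha : ∀ i, a i ∈ F) {d : L} (hd : d ∈ F) (n : ι → ℕ) :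
    ∃ c : (ι → Fin p) → L, (∀ α, c α ∈ F) ∧
      d ^ p * ∏ i, a i ^ n i = ∑ α : ι → Fin p, c α ^ p * ∏ i, a i ^ ((α i : ℕ)) := by
  have hp : p.Prime := Fact.out
  let α₀ : ι → Fin p := fun i => ⟨n i % p, Nat.mod_lt _ hp.pos⟩
  let d' : L := d * ∏ i, a i ^ (n i / p)
  have hd' : d' ∈ F := mul_mem hd (prod_mem fun i _ => pow_mem (ha i) _)
  refine ⟨Pi.single α₀ d', fun α => ?_, ?_⟩
  · rcases eq_or_ne α α₀ with rfl | hα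
    · rwa [Pi.single_eq_same]
    · rw [Pi.single_eq_of_ne hα]
      exact zero_mem F
  · rw [Finset.sum_eq_single α₀
      (fun α _ hα => by rw [Pi.single_eq_of_ne hα, zero_pow hp.ne_zero, zero_mul])
      (fun h => (h (Finset.mem_univ _)).elim), Pi.single_eq_same]
    show d ^ p * ∏ i, a i ^ n i = (d * ∏ i, a i ^ (n i / p)) ^ p * ∏ i, a i ^ (n i % p)
    rw [mul_pow, ← Finset.prod_pow, mul_assoc, ← Finset.prod_mul_distrib]
    refine congrArg (d ^ p * ·) (Finset.prod_congr rfl fun i _ => ?_)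
    rw [← pow_mul, ← pow_add, Nat.div_add_mod']

/-- Multiplying a normal form by a single term gives a normal form. -/
private theorem isFrobSum_mul_term [CharP L p] (ha : ∀ i, a i ∈ F) {x d : L}
    (hx : ∃ c : (ι → Fin p) → L, (∀ α, c α ∈ F) ∧
      x = ∑ α : ι → Fin p, c α ^ p * ∏ i, a i ^ ((α i : ℕ)))
    (hd : d ∈ F) (n : ι → ℕ) :
    ∃ c : (ι → Fin p) → L, (∀ α, c α ∈ F) ∧
      x * (d ^ p * ∏ i, a i ^ n i) = ∑ α : ι → Fin p, c α ^ p * ∏ i, a i ^ ((α i : ℕ)) := by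
  obtain ⟨c, hc, rfl⟩ := hx
  rw [Finset.sum_mul]
  refine isFrobSum_sum _ _ fun α _ => ?_
  have : c α ^ p * (∏ i, a i ^ (α i : ℕ)) * (d ^ p * ∏ i, a i ^ n i) =
      (c α * d) ^ p * ∏ i, a i ^ ((α i : ℕ) + n i) := by
    rw [mul_pow, Finset.prod_congr rfl fun i _ => pow_add (a i) (α i : ℕ) (n i),
      Finset.prod_mul_distrib]
    ring
  rw [this]
  exact isFrobSum_term ha (mul_mem (hc α) hd) _

/-- Normal forms are closed under multiplication. -/
private theorem isFrobSum_mul [CharP L p] (ha : ∀ i, a i ∈ F) {x y : L}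
    (hx : ∃ c : (ι → Fin p) → L, (∀ α, c α ∈ F) ∧
      x = ∑ α : ι → Fin p, c α ^ p * ∏ i, a i ^ ((α i : ℕ)))
    (hy : ∃ c : (ι → Fin p) → L, (∀ α, c α ∈ F) ∧
      y = ∑ α : ι → Fin p, c α ^ p * ∏ i, a i ^ ((α i : ℕ))) :
    ∃ c : (ι → Fin p) → L, (∀ α, c α ∈ F) ∧
      x * y = ∑ α : ι → Fin p, c α ^ p * ∏ i, a i ^ ((α i : ℕ)) := by
  obtain ⟨d, hd, rfl⟩ := hy
  rw [Finset.mul_sum]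
  exact isFrobSum_sum _ _ fun β _ => isFrobSum_mul_term ha hx (hd β) _

/-- `1` is a normal form. -/
private theorem isFrobSum_one (ha : ∀ i, a i ∈ F) :
    ∃ c : (ι → Fin p) → L, (∀ α, c α ∈ F) ∧
      (1 : L) = ∑ α : ι → Fin p, c α ^ p * ∏ i, a i ^ ((α i : ℕ)) := by
  simpa using isFrobSum_term (p := p) ha (one_mem F) 0

/-- Normal forms are closed under powers. -/
private theorem isFrobSum_pow [CharP L p] (ha : ∀ i, a i ∈ F) {x : L}
    (hx : ∃ c : (ι → Fin p) → L, (∀ α, c α ∈ F) ∧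
      x = ∑ α : ι → Fin p, c α ^ p * ∏ i, a i ^ ((α i : ℕ))) (m : ℕ) :
    ∃ c : (ι → Fin p) → L, (∀ α, c α ∈ F) ∧
      x ^ m = ∑ α : ι → Fin p, c α ^ p * ∏ i, a i ^ ((α i : ℕ)) := by
  induction m with
  | zero => rw [pow_zero]; exact isFrobSum_one ha
  | succ m ih => rw [pow_succ]; exact isFrobSum_mul ha ih hx

/-- Multiplying a normal form by the `p`-th power of an element of `F` gives a normal form. -/
private theorem isFrobSum_mul_pow [CharP L p] (ha : ∀ i, a i ∈ F) {x d : L}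
    (hx : ∃ c : (ι → Fin p) → L, (∀ α, c α ∈ F) ∧
      x = ∑ α : ι → Fin p, c α ^ p * ∏ i, a i ^ ((α i : ℕ))) (hd : d ∈ F) :
    ∃ c : (ι → Fin p) → L, (∀ α, c α ∈ F) ∧
      x * d ^ p = ∑ α : ι → Fin p, c α ^ p * ∏ i, a i ^ ((α i : ℕ)) := by
  simpa using isFrobSum_mul_term ha hx hd 0

/-- The inverse of a normal form lying in `F` is a normal form: `x⁻¹ = x^(p-1) * (x⁻¹)^p`. -/
private theorem isFrobSum_inv [CharP L p] (ha : ∀ i, a i ∈ F) {x : L} (hxF : x ∈ F)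
    (hx : ∃ c : (ι → Fin p) → L, (∀ α, c α ∈ F) ∧
      x = ∑ α : ι → Fin p, c α ^ p * ∏ i, a i ^ ((α i : ℕ))) :
    ∃ c : (ι → Fin p) → L, (∀ α, c α ∈ F) ∧
      x⁻¹ = ∑ α : ι → Fin p, c α ^ p * ∏ i, a i ^ ((α i : ℕ)) := by
  rcases eq_or_ne x 0 with rfl | hx0
  · rw [inv_zero]
    exact isFrobSum_zero
  have hp : p ≠ 0 := (Fact.out : p.Prime).ne_zero
  have : x⁻¹ = x ^ (p - 1) * x⁻¹ ^ p := by
    rw [← pow_sub_one_mul hp, ← mul_assoc, ← mul_pow, mul_inv_cancel₀ hx0, one_pow, one_mul]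
  rw [this]
  exact isFrobSum_mul_pow ha (isFrobSum_pow ha hx (p - 1)) (inv_mem hxF)

end Helpers

/-- Stub C1: Frobenius decomposition of `k(a_1, …, a_n)` over a perfect field. -/
theorem exists_sum_frobenius_mul_monomial (p : ℕ) [Fact p.Prime] (k L : Type) [Field k]
    [CharP k p] [PerfectField k] [Field L] [Algebra k L] {ι : Type} [Fintype ι] [DecidableEq ι]
    (a : ι → L) (x : L) (hx : x ∈ IntermediateField.adjoin k (Set.range a)) :
    ∃ c : (ι → Fin p) → L, (∀ α, c α ∈ IntermediateField.adjoin k (Set.range a)) ∧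
      x = ∑ α : ι → Fin p, c α ^ p * ∏ i, a i ^ ((α i : ℕ)) := by
  haveI : CharP L p := charP_of_injective_algebraMap (algebraMap k L).injective p
  have ha : ∀ i, a i ∈ IntermediateField.adjoin k (Set.range a) :=
    fun i => IntermediateField.subset_adjoin k _ ⟨i, rfl⟩
  induction hx using IntermediateField.adjoin_induction with
  | mem x hx =>
    obtain ⟨i, rfl⟩ := hx
    have : a i = 1 ^ p * ∏ j, a j ^ (Pi.single i 1 : ι → ℕ) j := by
      rw [one_pow, one_mul, Finset.prod_eq_single i (fun j _ hj => by simp [hj]) (by simp)]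
      simp
    rw [this]
    exact isFrobSum_term ha (one_mem _) _
  | algebraMap y =>
    obtain ⟨z, rfl⟩ := surjective_frobenius k p y
    rw [frobenius_def, map_pow, ← one_mul (algebraMap k L z ^ p)]
    exact isFrobSum_mul_pow ha (isFrobSum_one ha) (IntermediateField.algebraMap_mem _ z)
  | add _ _ _ _ ihx ihy => exact isFrobSum_add ihx ihy
  | inv _ hx ihx => exact isFrobSum_inv ha hx ihx
  | mul _ _ _ _ ihx ihy => exact isFrobSum_mul ha ihx ihy

end Summit.ResolutionOfSingularities.ResolutionOfSingularities.Theorems.ValuativeSmoothing
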